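import Literature.NumberTheory.Automorphic.LocalFieldHaarBalls
import HarnessLib

/-!
# Tate's local computations: quasi-characters on shells, unit filtration, Gauss sums

Topic `NumberTheory/Automorphic`; theorems only (no definition, no named fact, no instance), in the
sub-namespace `Literature.NumberTheory.Automorphic.TateDirect`. For a non-archimedean local field
`F` with additive Haar measure `μ`, a non-trivial additive character `ψ` of conductor exponent `m`
(`AddChar.HasConductorExp`) and a quasi-character `χ` of `Fˣ` (extended by `0` to `F`,
`Function.extend Units.val χ 0`), we prove the elementary integrals behind Tate's computation of
the local functional equation (Tate 1950, §2.5; Bushnell–Henniart 2006, §23.5):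

* the unit filtration `U^n` (`1 + 𝔭^n ⊆ U^n`, stability of shells and translates under `U^n`;
  the conductor exponent itself exists by `QuasiChar.exists_hasConductorExp` of `TateLocalZetaShells`);
* vanishing by a multiplicative twist (`χ(u) ≠ 1`, `‖u‖ = 1`) and by an additive shift
  (`ψ(t) ≠ 1`): `∫_{shell} χ = 0` for ramified `χ`, `∫_{a + 𝔭^ℓ} χ ‖·‖^w` is `χ(a) ‖a‖^w μ(𝔭^ℓ)` or
  `0`, and **the Gauss sums `∫_{𝔭^j ∖ 𝔭^{j+1}} ψ χ dμ` vanish unless `j = m - a(χ)`** for ramified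
  `χ` of conductor exponent `a(χ) ≥ 1`;
* the unramified evaluations `∫_{shell j} χ = χ(ϖ)^j μ(shell j)` and
  `∫_{shell j} ψ χ = χ(ϖ)^j (μ(𝔭^j) [j ≥ m] - μ(𝔭^{j+1}) [j+1 ≥ m])`;
* the shell expansions (absolutely convergent in Tate's strip) of
  `∫_{𝔭^n ∖ 0} φ(x) χ(x) ‖x‖^w dμ` for `‖φ‖ ≤ 1`.

## References

* J. Tate, *Fourier analysis in number fields and Hecke's zeta-functions* (1950), §2.3–2.5.
* C. J. Bushnell, G. Henniart, *The local Langlands conjecture for GL(2)* (2006), §1.8, §23.5.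
-/

set_option autoImplicit false

noncomputable section

open MeasureTheory ValuativeRel Filter Topology Set
open scoped NNReal ENNReal Pointwise
open Literature.NumberTheory.GaloisRepresentations.IsNonarchimedeanLocalField

namespace Literature.NumberTheory.Automorphic

namespace TateDirect

/-! ### Quasi-characters extended by zero -/

section Extend

variable {F : Type*} [Field F] [TopologicalSpace F] (χ : QuasiChar F)

/-- `χ̃(u) = χ(u)` on units. [folklore] -/
theorem extend_apply_coe (u : Fˣ) :
    Function.extend ((↑) : Fˣ → F) (fun u => ((χ u : ℂˣ) : ℂ)) 0 (u : F) = χ u :=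
  Units.val_injective.extend_apply _ _ u

/-- `χ̃(x) = χ(x)` for `x ≠ 0`. [folklore] -/
theorem extend_apply_of_ne_zero {x : F} (hx : x ≠ 0) :
    Function.extend ((↑) : Fˣ → F) (fun u => ((χ u : ℂˣ) : ℂ)) 0 x = χ (Units.mk0 x hx) :=
  extend_apply_coe χ (Units.mk0 x hx)

/-- `χ̃(0) = 0`. [folklore] -/
theorem extend_apply_zero : Function.extend ((↑) : Fˣ → F) (fun u => ((χ u : ℂˣ) : ℂ)) 0 0 = 0 := by
  rw [Function.extend_apply' _ _ _ (fun ⟨u, hu⟩ => u.ne_zero hu)]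
  rfl

/-- `χ̃` is multiplicative off `0`. [folklore] -/
theorem extend_mul {x y : F} (hx : x ≠ 0) (hy : y ≠ 0) :
    Function.extend ((↑) : Fˣ → F) (fun u => ((χ u : ℂˣ) : ℂ)) 0 (x * y) =
      Function.extend ((↑) : Fˣ → F) (fun u => ((χ u : ℂˣ) : ℂ)) 0 x *
        Function.extend ((↑) : Fˣ → F) (fun u => ((χ u : ℂˣ) : ℂ)) 0 y := by
  rw [extend_apply_of_ne_zero χ (mul_ne_zero hx hy), extend_apply_of_ne_zero χ hx,
    extend_apply_of_ne_zero χ hy, ← Units.val_mul, ← map_mul, Units.mk0_mul]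

/-- `χ̃(u x) = χ(u) χ̃(x)` for a unit `u` and all `x`. [folklore] -/
theorem extend_coe_mul (u : Fˣ) (x : F) :
    Function.extend ((↑) : Fˣ → F) (fun u => ((χ u : ℂˣ) : ℂ)) 0 ((u : F) * x) =
      ((χ u : ℂˣ) : ℂ) * Function.extend ((↑) : Fˣ → F) (fun u => ((χ u : ℂˣ) : ℂ)) 0 x := by
  by_cases hx : x = 0
  · rw [hx, mul_zero, extend_apply_zero, mul_zero]
  · rw [extend_mul χ u.ne_zero hx, extend_apply_coe]

/-- `χ̃(x) ≠ 0` for `x ≠ 0`. [folklore] -/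
theorem extend_ne_zero {x : F} (hx : x ≠ 0) :
    Function.extend ((↑) : Fˣ → F) (fun u => ((χ u : ℂˣ) : ℂ)) 0 x ≠ 0 := by
  rw [extend_apply_of_ne_zero χ hx]
  exact (χ _).ne_zero

/-- `(χ⁻¹)(u) = (χ u)⁻¹`. [folklore] -/
theorem inv_apply' (u : Fˣ) : (χ⁻¹ : QuasiChar F) u = (χ u)⁻¹ := rfl

end Extend

variable {F : Type*} [Field F] [ValuativeRel F] [TopologicalSpace F] [IsNonarchimedeanLocalField F]

section ExtendLocal

variable (χ : QuasiChar F)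

/-- `‖χ̃(x)‖ = ‖x‖^σ` for `x ≠ 0`, `σ` the exponent of `χ`. [folklore] -/
theorem norm_extend {σ : ℝ} (hσ : χ.HasExponent σ) {x : F} (hx : x ≠ 0) :
    ‖Function.extend ((↑) : Fˣ → F) (fun u => ((χ u : ℂˣ) : ℂ)) 0 x‖ = ((normAbs F x : ℝ≥0) : ℝ) ^ σ := by
  rw [extend_apply_of_ne_zero χ hx]
  exact hσ _

/-- `χ̃` is measurable (continuous off `0`). [folklore] -/
theorem measurable_extend [MeasurableSpace F] [BorelSpace F] :
    Measurable (Function.extend ((↑) : Fˣ → F) (fun u => ((χ u : ℂˣ) : ℂ)) 0) := by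
  haveI : T2Space F := (GaloisRepresentations.IsNonarchimedeanLocalField.isLocalField F).toT2Space
  refine measurable_of_continuousOn_compl_singleton 0 fun x hx => ?_
  have hx0 : x ≠ 0 := hx
  refine ContinuousAt.continuousWithinAt ?_
  have h := (LocalFieldHaar.isOpenEmbedding_unitsVal (F := F)).continuousAt_iff
    (g := Function.extend ((↑) : Fˣ → F) (fun u => ((χ u : ℂˣ) : ℂ)) 0) (x := Units.mk0 x hx0)
  rw [Function.extend_comp Units.val_injective] at h
  exact h.1 (Units.continuous_val.comp (map_continuous χ)).continuousAt

/-- `χ⁻¹` is unramified iff `χ` is. [folklore] -/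
theorem isUnramified_inv_iff : (χ⁻¹ : QuasiChar F).IsUnramified ↔ χ.IsUnramified := by
  simp only [QuasiChar.IsUnramified, inv_apply', inv_eq_one]

/-- `χ⁻¹` has exponent `-σ` if `χ` has exponent `σ`. [folklore] -/
theorem hasExponent_inv {σ : ℝ} (hσ : χ.HasExponent σ) : (χ⁻¹ : QuasiChar F).HasExponent (-σ) := by
  intro u
  rw [inv_apply', Units.val_inv_eq_inv_val, norm_inv, hσ u, Real.rpow_neg (NNReal.coe_nonneg _)]

/-- `χ⁻¹` has the same conductor exponent as `χ`. [folklore] -/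
theorem hasConductorExp_inv_iff {c : ℕ} :
    (χ⁻¹ : QuasiChar F).HasConductorExp c ↔ χ.HasConductorExp c := by
  simp only [QuasiChar.HasConductorExp, inv_apply', inv_eq_one, ne_eq]

end ExtendLocal

/-! ### The unit filtration and the conductor exponent -/

section UnitFiltration

/-- `U^0 = 𝒪ˣ`: the condition `‖u - 1‖ ≤ 1` is automatic when `‖u‖ = 1`. [folklore] -/
theorem mem_unitFiltration_zero_iff {u : Fˣ} : u ∈ unitFiltration F 0 ↔ normAbs F (u : F) = 1 := by
  refine ⟨fun h => h.1, fun h => ⟨h, ?_⟩⟩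
  rw [pow_zero]
  calc normAbs F ((u : F) - 1) = normAbs F ((u : F) + (-1)) := by rw [sub_eq_add_neg]
    _ ≤ max (normAbs F (u : F)) (normAbs F (-1 : F)) := normAbs_add_le_max _ _
    _ = 1 := by rw [normAbs_neg, map_one, h, max_self]

/-- `1 + t ∈ U^n` (as a unit) for `t ∈ 𝔭^n`, `n ≥ 1`. [folklore] -/
theorem one_add_mem_unitFiltration {n : ℕ} (hn : 1 ≤ n) {t : F} (ht : t ∈ primePowBall F n)
    (h0 : 1 + t ≠ 0) : Units.mk0 (1 + t) h0 ∈ unitFiltration F n := by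
  rw [mem_unitFiltration_iff_sub_one_mem hn _, Units.val_mk0, add_sub_cancel_left]
  exact ht

/-- `1 + t ≠ 0` for `t ∈ 𝔭^n`, `n ≥ 1`. [folklore] -/
theorem one_add_ne_zero {n : ℕ} (hn : 1 ≤ n) {t : F} (ht : t ∈ primePowBall F n) : 1 + t ≠ 0 := by
  intro h
  have ht' : normAbs F t = 1 := by
    rw [eq_neg_of_add_eq_zero_right h, normAbs_neg, map_one]
  rw [mem_primePowBall_iff, ht', zpow_natCast] at ht
  exact not_lt.2 ht (pow_lt_one₀ bot_le inv_residueFieldCard_lt_one (by omega))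

/-- `‖(u - 1) x‖ ≤ (q⁻¹)^(n + j)` for `u ∈ U^n` and `x ∈ 𝔭^j`. [folklore] -/
theorem sub_one_mul_mem_primePowBall {n : ℕ} {u : Fˣ} (hu : u ∈ unitFiltration F n) {j : ℤ} {x : F}
    (hx : x ∈ primePowBall F j) : ((u : F) - 1) * x ∈ primePowBall F (n + j) := by
  refine mul_mem_primePowBall ?_ hx
  rw [mem_primePowBall_iff, zpow_natCast]
  exact hu.2

/-- A ramified quasi-character has conductor exponent `≥ 1`. [folklore] -/
theorem one_le_of_hasConductorExp_of_not_isUnramified {χ : QuasiChar F} (hχ : ¬ χ.IsUnramified) {c : ℕ}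
    (hc : χ.HasConductorExp c) : 1 ≤ c := by
  by_contra h
  have hc0 : c = 0 := by omega
  subst hc0
  exact hχ (QuasiChar.hasConductorExp_zero_iff_holds.1 hc)

/-- A ramified quasi-character is non-trivial on some unit of norm `1`. [folklore] -/
theorem exists_normAbs_eq_one_ne_one {χ : QuasiChar F} (hχ : ¬ χ.IsUnramified) :
    ∃ u : Fˣ, normAbs F (u : F) = 1 ∧ χ u ≠ 1 := by
  by_contra h
  push Not at h
  exact hχ h

end UnitFiltration

/-! ### Shells and quasi-characters -/

section Shells

omit [TopologicalSpace F] [IsNonarchimedeanLocalField F] in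
/-- `‖x‖ = ‖y‖ ↔ v x = v y`. [folklore] -/
theorem normAbs_eq_normAbs_iff [TopologicalSpace F] [IsNonarchimedeanLocalField F] {x y : F} :
    normAbs F x = normAbs F y ↔ valuation F x = valuation F y := by
  rw [le_antisymm_iff, le_antisymm_iff, normAbs_le_normAbs_iff, normAbs_le_normAbs_iff]

/-- **An unramified quasi-character is constant on shells**: `χ̃(x) = χ(ϖ)^j` for
`‖x‖ = (q⁻¹)^j` and `‖ϖ‖ = q⁻¹`. [folklore] -/
theorem extend_eq_pow_of_mem_shell {χ : QuasiChar F} (hχ : χ.IsUnramified) {ϖ : F}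
    (hϖ : normAbs F ϖ = (residueFieldCard F : ℝ≥0)⁻¹) {j : ℤ} {x : F}
    (hx : x ∈ primePowBall F j \ primePowBall F (j + 1)) :
    Function.extend ((↑) : Fˣ → F) (fun u => ((χ u : ℂˣ) : ℂ)) 0 x =
      ((χ (Units.mk0 ϖ (by rintro rfl; rw [map_zero] at hϖ; exact inv_residueFieldCard_pos.ne hϖ)) :
        ℂˣ) : ℂ) ^ j := by
  have hϖ0 : ϖ ≠ 0 := by rintro rfl; rw [map_zero] at hϖ; exact inv_residueFieldCard_pos.ne hϖ
  have hx0 : x ≠ 0 := LocalFieldHaar.ne_zero_of_mem_shell hx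
  rw [LocalFieldHaar.mem_shell_iff] at hx
  have : valuation F x = valuation F (ϖ ^ j) := by
    rw [← normAbs_eq_normAbs_iff, hx, map_zpow₀, hϖ]
  have hmk : Units.mk0 (ϖ ^ j) (zpow_ne_zero j hϖ0) = (Units.mk0 ϖ hϖ0) ^ j := by
    ext
    simp
  rw [extend_apply_of_ne_zero χ hx0, hχ.apply_mk0_eq hx0 (zpow_ne_zero j hϖ0) this, hmk, map_zpow,
    Units.val_zpow_eq_zpow_val]

variable [MeasurableSpace F] [BorelSpace F] (μ : Measure F) [μ.IsAddHaarMeasure]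

/-- **Vanishing by a multiplicative twist**: if `‖u‖ = 1` and `g(u x) = c g(x)` with `c ≠ 1`, then
`∫ g dμ = 0` (Tate 1950, §2.5). [folklore] -/
theorem integral_eq_zero_of_twist (g : F → ℂ) {u : F} (hu : normAbs F u = 1) {c : ℂ} (hc : c ≠ 1)
    (h : ∀ x, g (u * x) = c * g x) : ∫ x, g x ∂μ = 0 := by
  have h1 : ∫ x, g x ∂μ = c * ∫ x, g x ∂μ := by
    calc ∫ x, g x ∂μ = ∫ x, g (u * x) ∂μ :=
          (LocalFieldHaar.integral_comp_mul_left_of_normAbs_eq_one μ g hu).symm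
      _ = ∫ x, c * g x ∂μ := by simp_rw [h]
      _ = c * ∫ x, g x ∂μ := integral_const_mul _ _
  have h2 : (1 - c) * ∫ x, g x ∂μ = 0 := by linear_combination h1
  exact (mul_eq_zero.1 h2).resolve_left (sub_ne_zero.2 (Ne.symm hc))

/-- **Vanishing by an additive shift**: if `g(t + x) = c g(x)` with `c ≠ 1`, then `∫ g dμ = 0`.
[folklore] -/
theorem integral_eq_zero_of_shift (g : F → ℂ) (t : F) {c : ℂ} (hc : c ≠ 1)
    (h : ∀ x, g (t + x) = c * g x) : ∫ x, g x ∂μ = 0 := by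
  have h1 : ∫ x, g x ∂μ = c * ∫ x, g x ∂μ := by
    calc ∫ x, g x ∂μ = ∫ x, g (t + x) ∂μ := (integral_add_left_eq_self _ t).symm
      _ = ∫ x, c * g x ∂μ := by simp_rw [h]
      _ = c * ∫ x, g x ∂μ := integral_const_mul _ _
  have h2 : (1 - c) * ∫ x, g x ∂μ = 0 := by linear_combination h1
  exact (mul_eq_zero.1 h2).resolve_left (sub_ne_zero.2 (Ne.symm hc))

/-- **Twisting a set integral of `φ χ̃`**: if `A` is stable under `x ↦ u x` (`‖u‖ = 1`), `φ` is
`u`-invariant on `A` and `χ(u) ≠ 1`, then `∫_A φ χ̃ dμ = 0` (Tate 1950, §2.5). [folklore] -/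
theorem setIntegral_mul_extend_eq_zero_of_twist (χ : QuasiChar F) {A : Set F} (hA : MeasurableSet A)
    {u : Fˣ} (hu1 : normAbs F (u : F) = 1) (huA : ∀ x, (u : F) * x ∈ A ↔ x ∈ A) (hχu : χ u ≠ 1)
    (φ : F → ℂ) (hφ : ∀ x ∈ A, φ ((u : F) * x) = φ x) :
    ∫ x in A, φ x * Function.extend ((↑) : Fˣ → F) (fun u => ((χ u : ℂˣ) : ℂ)) 0 x ∂μ = 0 := by
  rw [← integral_indicator hA]
  refine integral_eq_zero_of_twist μ _ hu1 (c := ((χ u : ℂˣ) : ℂ)) ?_ fun x => ?_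
  · exact fun h => hχu (Units.val_eq_one.1 h)
  · by_cases hx : x ∈ A
    · rw [Set.indicator_of_mem ((huA x).2 hx), Set.indicator_of_mem hx, hφ x hx, extend_coe_mul]
      ring
    · rw [Set.indicator_of_notMem (mt (huA x).1 hx), Set.indicator_of_notMem hx, mul_zero]

omit [MeasurableSpace F] [BorelSpace F] in
/-- Shells are stable under multiplication by units of norm `1`. [folklore] -/
theorem coe_mul_mem_shell_iff {u : Fˣ} (hu1 : normAbs F (u : F) = 1) (j : ℤ) (x : F) :
    (u : F) * x ∈ primePowBall F j \ primePowBall F (j + 1) ↔ x ∈ primePowBall F j \ primePowBall F (j + 1) := by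
  rw [LocalFieldHaar.mem_shell_iff, LocalFieldHaar.mem_shell_iff, map_mul, hu1, one_mul]

/-- **`∫_{shell} φ χ̃ = 0` for ramified `χ`** and any twist-invariant `φ` (e.g. `‖x‖^w`)
(Tate 1950, §2.5). [folklore] -/
theorem setIntegral_shell_mul_extend_eq_zero {χ : QuasiChar F} (hχ : ¬ χ.IsUnramified) (j : ℤ)
    (φ : F → ℂ) (hφ : ∀ (u : Fˣ), normAbs F (u : F) = 1 → ∀ x, φ ((u : F) * x) = φ x) :
    ∫ x in primePowBall F j \ primePowBall F (j + 1),
      φ x * Function.extend ((↑) : Fˣ → F) (fun u => ((χ u : ℂˣ) : ℂ)) 0 x ∂μ = 0 := by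
  obtain ⟨u, hu1, hχu⟩ := exists_normAbs_eq_one_ne_one hχ
  exact setIntegral_mul_extend_eq_zero_of_twist μ χ (LocalFieldHaar.measurableSet_shell j) hu1
    (coe_mul_mem_shell_iff hu1 j) hχu φ fun x _ => hφ u hu1 x

omit [μ.IsAddHaarMeasure] in
/-- **`∫_{shell j} φ χ̃ = χ(ϖ)^j ∫_{shell j} φ` for unramified `χ`.** [folklore] -/
theorem setIntegral_shell_mul_extend_of_isUnramified {χ : QuasiChar F} (hχ : χ.IsUnramified) {ϖ : F}
    (hϖ : normAbs F ϖ = (residueFieldCard F : ℝ≥0)⁻¹) (j : ℤ) (φ : F → ℂ) :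
    ∫ x in primePowBall F j \ primePowBall F (j + 1),
      φ x * Function.extend ((↑) : Fˣ → F) (fun u => ((χ u : ℂˣ) : ℂ)) 0 x ∂μ =
      ((χ (Units.mk0 ϖ (by rintro rfl; rw [map_zero] at hϖ; exact inv_residueFieldCard_pos.ne hϖ)) :
        ℂˣ) : ℂ) ^ j * ∫ x in primePowBall F j \ primePowBall F (j + 1), φ x ∂μ := by
  rw [← integral_const_mul, setIntegral_congr_fun (LocalFieldHaar.measurableSet_shell j)]
  intro x hx
  simp only [extend_eq_pow_of_mem_shell hχ hϖ hx]
  ring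

omit [μ.IsAddHaarMeasure] in
/-- **`∫_{shell j} χ̃ = χ(ϖ)^j μ(shell j)` for unramified `χ`.** [folklore] -/
theorem setIntegral_shell_extend_of_isUnramified {χ : QuasiChar F} (hχ : χ.IsUnramified) {ϖ : F}
    (hϖ : normAbs F ϖ = (residueFieldCard F : ℝ≥0)⁻¹) (j : ℤ) :
    ∫ x in primePowBall F j \ primePowBall F (j + 1),
      Function.extend ((↑) : Fˣ → F) (fun u => ((χ u : ℂˣ) : ℂ)) 0 x ∂μ =
      ((χ (Units.mk0 ϖ (by rintro rfl; rw [map_zero] at hϖ; exact inv_residueFieldCard_pos.ne hϖ)) :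
        ℂˣ) : ℂ) ^ j * μ.real (primePowBall F j \ primePowBall F (j + 1)) := by
  have h := setIntegral_shell_mul_extend_of_isUnramified μ hχ hϖ j (fun _ => (1 : ℂ))
  simp only [one_mul] at h
  rw [h, setIntegral_const, Complex.real_smul, mul_one]

/-! ### Translates `a + 𝔭^ℓ` with `a ∉ 𝔭^ℓ` -/

omit [MeasurableSpace F] [BorelSpace F] in
/-- For `a ∉ 𝔭^ℓ`, every `x ∈ a + 𝔭^ℓ` is non-zero with `‖x‖ = ‖a‖`. [folklore] -/
theorem normAbs_eq_of_sub_mem {a : F} {ℓ : ℤ} (ha : a ∉ primePowBall F ℓ) {x : F}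
    (hx : x - a ∈ primePowBall F ℓ) : normAbs F x = normAbs F a := by
  have hlt : normAbs F (x - a) < normAbs F a := lt_of_le_of_lt hx (not_le.1 ha)
  have := LocalFieldHaar.normAbs_add_eq_of_lt hlt
  rwa [add_sub_cancel] at this

omit [MeasurableSpace F] [BorelSpace F] in
/-- For `a ∉ 𝔭^ℓ` with `‖a‖ = (q⁻¹)^v`, the quotient `x/a` of `x ∈ a + 𝔭^ℓ` lies in
`U^{ℓ - v}` (and `ℓ - v ≥ 1`). [folklore] -/
theorem div_mem_unitFiltration {a : F} {ℓ v : ℤ} (ha : a ∉ primePowBall F ℓ)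
    (hav : normAbs F a = ((residueFieldCard F : ℝ≥0)⁻¹) ^ v) {x : F} (hx : x - a ∈ primePowBall F ℓ)
    (ha0 : a ≠ 0) (hx0 : x ≠ 0) :
    1 ≤ (ℓ - v).toNat ∧ Units.mk0 x hx0 * (Units.mk0 a ha0)⁻¹ ∈ unitFiltration F (ℓ - v).toNat := by
  have hvl : v < ℓ := by
    rw [mem_primePowBall_iff, hav, not_le,
      zpow_lt_zpow_iff_right_of_lt_one₀ inv_residueFieldCard_pos inv_residueFieldCard_lt_one] at ha
    exact ha
  have h1 : 1 ≤ (ℓ - v).toNat := by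
    have := Int.self_le_toNat (ℓ - v)
    omega
  refine ⟨h1, (mem_unitFiltration_iff_sub_one_mem h1 _).2 ?_⟩
  rw [Units.val_mul, Units.val_inv_eq_inv_val, Units.val_mk0, Units.val_mk0,
    show x * a⁻¹ - 1 = a⁻¹ * (x - a) by field_simp,
    mul_mem_primePowBall_iff (k := -v) (by rw [map_inv₀, hav, zpow_neg]), Int.toNat_of_nonneg (by omega)]
  simpa using hx

omit [MeasurableSpace F] [BorelSpace F] in
/-- The translate `a + 𝔭^ℓ` (`a ∉ 𝔭^ℓ`, `‖a‖ = (q⁻¹)^v`) is stable under `x ↦ u x` for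
`u ∈ U^{ℓ-v}`. [folklore] -/
theorem coe_mul_sub_mem_iff {a : F} {ℓ v : ℤ} (hav : normAbs F a = ((residueFieldCard F : ℝ≥0)⁻¹) ^ v)
    {u : Fˣ} (hu : u ∈ unitFiltration F (ℓ - v).toNat) (hvl : v < ℓ) (x : F) :
    (u : F) * x - a ∈ primePowBall F ℓ ↔ x - a ∈ primePowBall F ℓ := by
  have key : ∀ (w : Fˣ), w ∈ unitFiltration F (ℓ - v).toNat → ∀ y : F, y - a ∈ primePowBall F ℓ →
      (w : F) * y - a ∈ primePowBall F ℓ := by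
    intro w hw y hy
    have h1 : (w : F) * y - a = (w : F) * (y - a) + ((w : F) - 1) * a := by ring
    rw [h1]
    refine add_mem_primePowBall ?_ ?_
    · rw [mem_primePowBall_iff, map_mul, hw.1, one_mul]
      exact hy
    · have := sub_one_mul_mem_primePowBall hw (le_of_eq hav : a ∈ primePowBall F v)
      rwa [Int.toNat_of_nonneg (by omega), sub_add_cancel] at this
  refine ⟨fun h => ?_, key u hu x⟩
  have hu' : u⁻¹ ∈ unitFiltration F (ℓ - v).toNat := by
    refine ⟨by rw [Units.val_inv_eq_inv_val, map_inv₀, hu.1, inv_one], ?_⟩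
    have : ((u⁻¹ : Fˣ) : F) - 1 = -(u : F)⁻¹ * ((u : F) - 1) := by
      rw [Units.val_inv_eq_inv_val]
      field_simp [u.ne_zero]
      ring
    rw [this, map_mul, normAbs_neg, map_inv₀, hu.1, inv_one, one_mul]
    exact hu.2
  have := key u⁻¹ hu' _ h
  rwa [← mul_assoc, Units.inv_mul, one_mul] at this

open scoped Classical in
/-- **`∫_{a + 𝔭^ℓ} φ χ̃ dμ`, `a ∉ 𝔭^ℓ`, `‖a‖ = (q⁻¹)^v`**, for `φ` twist-invariant on the translate:
it is `χ(a) ∫_{a+𝔭^ℓ} φ` if `χ` is trivial on `U^{ℓ-v}`, and `0` otherwise (Tate 1950, §2.5,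
the computation of `ζ(f, c)` on `1 + 𝔭^n`). [folklore] -/
theorem setIntegral_translate_mul_extend {χ : QuasiChar F} {a : F} {ℓ v : ℤ}
    (ha : a ∉ primePowBall F ℓ) (hav : normAbs F a = ((residueFieldCard F : ℝ≥0)⁻¹) ^ v) (ha0 : a ≠ 0)
    (φ : F → ℂ) (hφ : ∀ (u : Fˣ), normAbs F (u : F) = 1 → ∀ x, φ ((u : F) * x) = φ x) :
    ∫ x in {x | x - a ∈ primePowBall F ℓ},
      φ x * Function.extend ((↑) : Fˣ → F) (fun u => ((χ u : ℂˣ) : ℂ)) 0 x ∂μ =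
      if ∀ u ∈ unitFiltration F (ℓ - v).toNat, χ u = 1 then
        ((χ (Units.mk0 a ha0) : ℂˣ) : ℂ) * ∫ x in {x | x - a ∈ primePowBall F ℓ}, φ x ∂μ
      else 0 := by
  have hAm : MeasurableSet {x : F | x - a ∈ primePowBall F ℓ} :=
    (measurableSet_primePowBall ℓ).preimage (measurable_sub_const a)
  have hvl : v < ℓ := by
    have := ha
    rw [mem_primePowBall_iff, hav, not_le,
      zpow_lt_zpow_iff_right_of_lt_one₀ inv_residueFieldCard_pos inv_residueFieldCard_lt_one] at this
    exact this
  split_ifs with htriv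
  · -- `χ̃ = χ(a)` on the translate
    rw [← integral_const_mul, setIntegral_congr_fun hAm]
    intro x hx
    have hx0 : x ≠ 0 := by
      rintro rfl
      rw [Set.mem_setOf_eq, zero_sub] at hx
      exact ha (by simpa using neg_mem_primePowBall hx)
    obtain ⟨-, hu⟩ := div_mem_unitFiltration ha hav hx ha0 hx0
    have h1 := htriv _ hu
    rw [map_mul, map_inv, mul_inv_eq_one] at h1
    simp only [extend_apply_of_ne_zero χ hx0, h1]
    ring
  · push Not at htriv
    obtain ⟨u, hu, hχu⟩ := htriv
    exact setIntegral_mul_extend_eq_zero_of_twist μ χ hAm hu.1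
      (fun x => coe_mul_sub_mem_iff hav hu hvl x) hχu φ fun x _ => hφ u hu.1 x

/-! ### Gauss sums `∫_{𝔭^j ∖ 𝔭^{j+1}} ψ χ̃ dμ` -/

omit [MeasurableSpace F] [BorelSpace F] in
/-- Shells are stable under adding elements of the next ball: `t + x ∈ S_j ↔ x ∈ S_j` for
`t ∈ 𝔭^{j+1}`. [folklore] -/
theorem add_mem_shell_iff {j : ℤ} {t : F} (ht : t ∈ primePowBall F (j + 1)) (x : F) :
    t + x ∈ primePowBall F j \ primePowBall F (j + 1) ↔ x ∈ primePowBall F j \ primePowBall F (j + 1) := by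
  have key : ∀ y : F, y ∈ primePowBall F j \ primePowBall F (j + 1) → ∀ t' ∈ primePowBall F (j + 1),
      t' + y ∈ primePowBall F j \ primePowBall F (j + 1) := by
    intro y hy t' ht'
    rw [LocalFieldHaar.mem_shell_iff] at hy ⊢
    have hlt : normAbs F t' < normAbs F y := by
      rw [hy]
      exact lt_of_le_of_lt ht' (LocalFieldHaar.inv_zpow_succ_lt j)
    rw [add_comm, LocalFieldHaar.normAbs_add_eq_of_lt hlt, hy]
  refine ⟨fun h => ?_, fun h => key x h t ht⟩
  have := key _ h (-t) (neg_mem_primePowBall ht)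
  rwa [neg_add_cancel_left] at this

/-- **Gauss sums below the critical shell vanish** (additive shift): for `ψ` of conductor
exponent `m` and `χ` ramified of conductor exponent `c ≥ 1`, `∫_{S_j} ψ χ̃ dμ = 0` whenever
`j + c < m` — shift by `t ∈ 𝔭^{j+c}` with `ψ(t) ≠ 1`; `χ̃(x + t) = χ̃(x)` on `S_j`
(Tate 1950, §2.5, the ramified computation). [folklore] -/
theorem setIntegral_shell_addChar_mul_extend_eq_zero_of_lt {ψ : AddChar F Circle} {m : ℤ}
    (hm : ψ.HasConductorExp m) {χ : QuasiChar F} {c : ℕ} (hc : χ.HasConductorExp c) (hc1 : 1 ≤ c)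
    {j : ℤ} (hj : j + c < m) :
    ∫ x in primePowBall F j \ primePowBall F (j + 1),
      (ψ x : ℂ) * Function.extend ((↑) : Fˣ → F) (fun u => ((χ u : ℂˣ) : ℂ)) 0 x ∂μ = 0 := by
  obtain ⟨t₀, ht₀, ht₀1⟩ := hm.2
  have ht₀' : t₀ ∈ primePowBall F (j + c) := primePowBall_antitone (by omega) ht₀
  have ht₀'' : t₀ ∈ primePowBall F (j + 1) := primePowBall_antitone (by omega) ht₀'
  rw [← integral_indicator (LocalFieldHaar.measurableSet_shell j)]
  refine integral_eq_zero_of_shift μ _ t₀ (c := (ψ t₀ : ℂ)) (fun h => ht₀1 (Circle.coe_eq_one.1 h))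
    fun x => ?_
  by_cases hx : x ∈ primePowBall F j \ primePowBall F (j + 1)
  · have hx0 : x ≠ 0 := LocalFieldHaar.ne_zero_of_mem_shell hx
    rw [Set.indicator_of_mem ((add_mem_shell_iff ht₀'' x).2 hx), Set.indicator_of_mem hx]
    -- `x + t₀ = u x` with `u = 1 + x⁻¹ t₀ ∈ U^c`
    have hxt : x⁻¹ * t₀ ∈ primePowBall F c := by
      have hxn := (LocalFieldHaar.mem_shell_iff.1 hx)
      rw [mul_mem_primePowBall_iff (k := -j) (by rw [map_inv₀, hxn, ← zpow_neg]), sub_neg_eq_add,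
        add_comm]
      exact ht₀'
    have h1 : (1 : F) + x⁻¹ * t₀ ≠ 0 := one_add_ne_zero hc1 hxt
    have hu : Units.mk0 _ h1 ∈ unitFiltration F c := one_add_mem_unitFiltration hc1 hxt h1
    have hext : Function.extend ((↑) : Fˣ → F) (fun u => ((χ u : ℂˣ) : ℂ)) 0 (t₀ + x) =
        Function.extend ((↑) : Fˣ → F) (fun u => ((χ u : ℂˣ) : ℂ)) 0 x := by
      have : t₀ + x = (Units.mk0 _ h1 : F) * x := by
        rw [Units.val_mk0]
        field_simp
        ring
      rw [this, extend_coe_mul, hc.1 _ hu, Units.val_one, one_mul]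
    rw [hext, AddChar.map_add_eq_mul, Circle.coe_mul]
    ring
  · rw [Set.indicator_of_notMem (mt (add_mem_shell_iff ht₀'' x).1 hx), Set.indicator_of_notMem hx,
      mul_zero]

/-- **Gauss sums above the critical shell vanish** (multiplicative twist): with `m`, `c ≥ 1` as
above, `∫_{S_j} ψ χ̃ dμ = 0` whenever `m < j + c` — twist by `u ∈ U^b`, `b = max(m - j, 0) < c`,
with `χ(u) ≠ 1`; `ψ(u x) = ψ(x)` on `S_j` (Tate 1950, §2.5). [folklore] -/
theorem setIntegral_shell_addChar_mul_extend_eq_zero_of_gt {ψ : AddChar F Circle} {m : ℤ}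
    (hm : ψ.HasConductorExp m) {χ : QuasiChar F} {c : ℕ} (hc : χ.HasConductorExp c) (hc1 : 1 ≤ c)
    {j : ℤ} (hj : m < j + c) :
    ∫ x in primePowBall F j \ primePowBall F (j + 1),
      (ψ x : ℂ) * Function.extend ((↑) : Fˣ → F) (fun u => ((χ u : ℂˣ) : ℂ)) 0 x ∂μ = 0 := by
  have hb : (m - j).toNat < c := by
    have := Int.toNat_lt' (n := c) (m := m - j) (by omega)
    omega
  obtain ⟨u, hu, hχu⟩ := hc.2 _ hb
  refine setIntegral_mul_extend_eq_zero_of_twist μ χ (LocalFieldHaar.measurableSet_shell j) hu.1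
    (coe_mul_mem_shell_iff hu.1 j) hχu _ fun x hx => ?_
  have h1 : (u : F) * x = x + ((u : F) - 1) * x := by ring
  have h2 : ((u : F) - 1) * x ∈ primePowBall F m := by
    refine primePowBall_antitone ?_ (sub_one_mul_mem_primePowBall hu hx.1)
    have := Int.self_le_toNat (m - j)
    omega
  rw [h1, AddChar.map_add_eq_mul, hm.1 _ h2, mul_one]

omit [MeasurableSpace F] [BorelSpace F] in
/-- `1 ∈ 𝔭^k ↔ k ≤ 0`. [folklore] -/
theorem one_mem_primePowBall_iff {k : ℤ} : (1 : F) ∈ primePowBall F k ↔ k ≤ 0 := by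
  rw [mem_primePowBall_iff, map_one,
    one_le_zpow_iff_right_of_lt_one₀ inv_residueFieldCard_pos inv_residueFieldCard_lt_one]

/-- `∫_{𝔭^ℓ} ψ dμ = μ(𝔭^ℓ) [m ≤ ℓ]` for `ψ` of conductor exponent `m`. [folklore] -/
theorem setIntegral_primePowBall_addChar_one {ψ : AddChar F Circle} {m : ℤ} (hm : ψ.HasConductorExp m)
    (ℓ : ℤ) : ∫ t in primePowBall F ℓ, (ψ t : ℂ) ∂μ = if m ≤ ℓ then (μ.real (primePowBall F ℓ) : ℂ) else 0 := by
  have h := setIntegral_primePowBall_addChar_mul μ hm ℓ 1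
  simp only [mul_one] at h
  rw [h]
  by_cases hml : m ≤ ℓ
  · rw [if_pos hml, if_pos (one_mem_primePowBall_iff.2 (by omega))]
  · rw [if_neg hml, if_neg (fun h' => hml (by have := one_mem_primePowBall_iff.1 h'; omega))]

omit [ValuativeRel F] [IsNonarchimedeanLocalField F] [MeasurableSpace F] [BorelSpace F] in
/-- Continuity of `ψ` as a complex-valued function. [folklore] -/
theorem continuous_addChar_coe {ψ : AddChar F Circle} (hψ : Continuous ψ) :
    Continuous fun x : F => (ψ x : ℂ) :=
  continuous_subtype_val.comp hψ

/-- **The unramified Gauss sums**: for `χ` unramified and `‖ϖ‖ = q⁻¹`,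
`∫_{S_j} ψ χ̃ dμ = χ(ϖ)^j (μ(𝔭^j) [m ≤ j] - μ(𝔭^{j+1}) [m ≤ j+1])` (Tate 1950, §2.5, the unramified
computation). [folklore] -/
theorem setIntegral_shell_addChar_mul_extend_of_isUnramified {ψ : AddChar F Circle} (hψ : Continuous ψ)
    {m : ℤ} (hm : ψ.HasConductorExp m) {χ : QuasiChar F} (hχ : χ.IsUnramified) {ϖ : F}
    (hϖ : normAbs F ϖ = (residueFieldCard F : ℝ≥0)⁻¹) (j : ℤ) :
    ∫ x in primePowBall F j \ primePowBall F (j + 1),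
      (ψ x : ℂ) * Function.extend ((↑) : Fˣ → F) (fun u => ((χ u : ℂˣ) : ℂ)) 0 x ∂μ =
      ((χ (Units.mk0 ϖ (by rintro rfl; rw [map_zero] at hϖ; exact inv_residueFieldCard_pos.ne hϖ)) :
        ℂˣ) : ℂ) ^ j *
        ((if m ≤ j then (μ.real (primePowBall F j) : ℂ) else 0) -
          (if m ≤ j + 1 then (μ.real (primePowBall F (j + 1)) : ℂ) else 0)) := by
  haveI : T2Space F := (GaloisRepresentations.IsNonarchimedeanLocalField.isLocalField F).toT2Space
  rw [setIntegral_shell_mul_extend_of_isUnramified μ hχ hϖ j, setIntegral_sdiff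
    (measurableSet_primePowBall _) ((continuous_addChar_coe hψ).continuousOn.integrableOn_compact
      (isCompact_primePowBall j)) (primePowBall_antitone (by omega)),
    setIntegral_primePowBall_addChar_one μ hm, setIntegral_primePowBall_addChar_one μ hm]

/-! ### Shell expansions of `∫_{𝔭^n ∖ 0} φ χ̃ ‖·‖^w dμ` -/

omit [MeasurableSpace F] [BorelSpace F] in
/-- `‖x‖ = q^{-k}` (as a real number) on the shell `S_k`. [folklore] -/
theorem coe_normAbs_of_mem_shell {k : ℤ} {x : F} (hx : x ∈ primePowBall F k \ primePowBall F (k + 1)) :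
    ((normAbs F x : ℝ≥0) : ℝ) = (residueFieldCard F : ℝ) ^ (-k) := by
  rw [LocalFieldHaar.mem_shell_iff] at hx
  rw [hx]
  push_cast
  rw [inv_zpow']

omit [MeasurableSpace F] [BorelSpace F] in
/-- `‖x‖^t = q^{-k t}` (real powers) on the shell `S_k`. [folklore] -/
theorem rpow_normAbs_of_mem_shell {k : ℤ} {x : F} (hx : x ∈ primePowBall F k \ primePowBall F (k + 1))
    (t : ℝ) : ((normAbs F x : ℝ≥0) : ℝ) ^ t = (residueFieldCard F : ℝ) ^ (-(k : ℝ) * t) := by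
  rw [coe_normAbs_of_mem_shell hx, ← Real.rpow_intCast, ← Real.rpow_mul (Nat.cast_nonneg _)]
  push_cast
  ring_nf

omit [MeasurableSpace F] [BorelSpace F] in
/-- `‖x‖^w = q^{-k w}` (complex powers) on the shell `S_k`. [folklore] -/
theorem cpow_normAbs_of_mem_shell {k : ℤ} {x : F} (hx : x ∈ primePowBall F k \ primePowBall F (k + 1))
    (w : ℂ) : (((normAbs F x : ℝ≥0) : ℝ) : ℂ) ^ w = (residueFieldCard F : ℂ) ^ (-(k : ℂ) * w) := by
  have hq : (residueFieldCard F : ℂ) ≠ 0 := Nat.cast_ne_zero.2 (residueFieldCard_ne_zero F)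
  rw [coe_normAbs_of_mem_shell hx, Complex.ofReal_zpow, Complex.ofReal_natCast, ← Complex.cpow_intCast,
    ← Complex.cpow_mul]
  · push_cast
    ring_nf
  · rw [← Complex.natCast_log, ← Complex.ofReal_intCast, ← Complex.ofReal_mul, Complex.ofReal_im]
    exact neg_lt_zero.2 Real.pi_pos
  · rw [← Complex.natCast_log, ← Complex.ofReal_intCast, ← Complex.ofReal_mul, Complex.ofReal_im]
    exact Real.pi_pos.le

omit [MeasurableSpace F] [BorelSpace F] in
/-- `q^{-k w} = (q^{-w})^k`. [folklore] -/
theorem natCast_cpow_neg_intCast_mul (k : ℤ) (w : ℂ) :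
    (residueFieldCard F : ℂ) ^ (-(k : ℂ) * w) = ((residueFieldCard F : ℂ) ^ (-w)) ^ k := by
  rw [← Complex.cpow_int_mul]
  ring_nf

omit [μ.IsAddHaarMeasure] in
/-- Pulling the constant `‖x‖^w = q^{-kw}` out of a shell integral. [folklore] -/
theorem setIntegral_shell_mul_cpow (g : F → ℂ) (k : ℤ) (w : ℂ) :
    ∫ x in primePowBall F k \ primePowBall F (k + 1), g x * (((normAbs F x : ℝ≥0) : ℝ) : ℂ) ^ w ∂μ =
      (residueFieldCard F : ℂ) ^ (-(k : ℂ) * w) * ∫ x in primePowBall F k \ primePowBall F (k + 1), g x ∂μ := by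
  rw [← integral_const_mul, setIntegral_congr_fun (LocalFieldHaar.measurableSet_shell k)]
  intro x hx
  simp only [cpow_normAbs_of_mem_shell hx]
  ring

/-- Measurability of `x ↦ ‖x‖^w` (complex power). [folklore] -/
theorem measurable_cpow_normAbs (w : ℂ) : Measurable fun x : F => (((normAbs F x : ℝ≥0) : ℝ) : ℂ) ^ w :=
  (Complex.measurable_ofReal.comp (measurable_coe_nnreal_real.comp LocalFieldHaar.measurable_normAbs)).pow_const w

/-- **Shell expansion of `∫_{𝔭^n ∖ 0} φ χ̃ ‖·‖^w dμ`** for `φ` measurable with `‖φ‖ ≤ 1`, `χ` of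
exponent `τ` and `τ + re w + 1 > 0` (Tate's strip): absolute convergence and
`∫ = ∑_{i ≥ 0} ∫_{S_{n+i}}` (Tate 1950, §2.4). [folklore] -/
theorem integrableOn_and_hasSum_mul_extend_cpow (φ : F → ℂ) (hφm : Measurable φ) (hφ1 : ∀ x, ‖φ x‖ ≤ 1)
    (χ : QuasiChar F) {τ : ℝ} (hτ : χ.HasExponent τ) (w : ℂ) (hw : 0 < τ + w.re + 1) (n : ℤ) :
    IntegrableOn (fun x => φ x * Function.extend ((↑) : Fˣ → F) (fun u => ((χ u : ℂˣ) : ℂ)) 0 x *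
        (((normAbs F x : ℝ≥0) : ℝ) : ℂ) ^ w) (primePowBall F n \ {0}) μ ∧
    HasSum (fun i : ℕ => ∫ x in primePowBall F (n + i) \ primePowBall F (n + i + 1),
        φ x * Function.extend ((↑) : Fˣ → F) (fun u => ((χ u : ℂˣ) : ℂ)) 0 x *
          (((normAbs F x : ℝ≥0) : ℝ) : ℂ) ^ w ∂μ)
      (∫ x in primePowBall F n \ {0}, φ x * Function.extend ((↑) : Fˣ → F) (fun u => ((χ u : ℂˣ) : ℂ)) 0 x *
          (((normAbs F x : ℝ≥0) : ℝ) : ℂ) ^ w ∂μ) := by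
  set q : ℝ := (residueFieldCard F : ℝ) with hq
  have hq1 : 1 < q := by rw [hq]; exact_mod_cast one_lt_residueFieldCard F
  have hq0 : 0 < q := zero_lt_one.trans hq1
  refine LocalFieldHaar.integrableOn_and_hasSum_shell μ _ ?_ n (C := q ^ (-(n : ℝ) * (τ + w.re)))
    (θ := q ^ (-(τ + w.re))) (Real.rpow_nonneg hq0.le _) (Real.rpow_nonneg hq0.le _) ?_ ?_
  · exact ((hφm.mul (measurable_extend χ)).mul (measurable_cpow_normAbs w)).aestronglyMeasurable
  · rw [hq]
    conv_rhs => rw [← Real.rpow_one (residueFieldCard F : ℝ)]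
    exact Real.rpow_lt_rpow_of_exponent_lt (by rw [← hq]; exact hq1) (by linarith)
  · intro i x hx
    have hx0 : x ≠ 0 := LocalFieldHaar.ne_zero_of_mem_shell hx
    have hpos : 0 < ((normAbs F x : ℝ≥0) : ℝ) := by
      exact_mod_cast pos_iff_ne_zero.2 ((map_ne_zero (normAbs F)).2 hx0)
    rw [norm_mul, norm_mul, norm_extend χ hτ hx0, Complex.norm_cpow_eq_rpow_re_of_pos hpos,
      rpow_normAbs_of_mem_shell hx, rpow_normAbs_of_mem_shell hx, ← hq]
    calc ‖φ x‖ * q ^ (-((n + i : ℤ) : ℝ) * τ) * q ^ (-((n + i : ℤ) : ℝ) * w.re)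
        ≤ 1 * q ^ (-((n + i : ℤ) : ℝ) * τ) * q ^ (-((n + i : ℤ) : ℝ) * w.re) := by
          gcongr
          exact hφ1 x
      _ = q ^ (-(n : ℝ) * (τ + w.re)) * (q ^ (-(τ + w.re))) ^ i := by
          rw [one_mul, ← Real.rpow_natCast, ← Real.rpow_mul hq0.le, ← Real.rpow_add hq0,
            ← Real.rpow_add hq0]
          push_cast
          ring_nf

/-- The same for the integrand `χ̃ ‖·‖^w` (no `φ`). [folklore] -/
theorem integrableOn_and_hasSum_extend_cpow (χ : QuasiChar F) {τ : ℝ} (hτ : χ.HasExponent τ) (w : ℂ)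
    (hw : 0 < τ + w.re + 1) (n : ℤ) :
    IntegrableOn (fun x => Function.extend ((↑) : Fˣ → F) (fun u => ((χ u : ℂˣ) : ℂ)) 0 x *
        (((normAbs F x : ℝ≥0) : ℝ) : ℂ) ^ w) (primePowBall F n \ {0}) μ ∧
    HasSum (fun i : ℕ => ∫ x in primePowBall F (n + i) \ primePowBall F (n + i + 1),
        Function.extend ((↑) : Fˣ → F) (fun u => ((χ u : ℂˣ) : ℂ)) 0 x *
          (((normAbs F x : ℝ≥0) : ℝ) : ℂ) ^ w ∂μ)
      (∫ x in primePowBall F n \ {0}, Function.extend ((↑) : Fˣ → F) (fun u => ((χ u : ℂˣ) : ℂ)) 0 x *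
          (((normAbs F x : ℝ≥0) : ℝ) : ℂ) ^ w ∂μ) := by
  have h := integrableOn_and_hasSum_mul_extend_cpow μ (fun _ => (1 : ℂ)) measurable_const (by simp) χ hτ w hw n
  simp only [one_mul] at h
  exact h

/-- **`∫_{𝔭^n ∖ 0} χ̃ ‖·‖^w dμ = 0` for ramified `χ`** (in the strip `τ + re w + 1 > 0`).
[folklore] -/
theorem integral_ball_extend_cpow_eq_zero {χ : QuasiChar F} (hχ : ¬ χ.IsUnramified) {τ : ℝ}
    (hτ : χ.HasExponent τ) (w : ℂ) (hw : 0 < τ + w.re + 1) (n : ℤ) :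
    ∫ x in primePowBall F n \ {0}, Function.extend ((↑) : Fˣ → F) (fun u => ((χ u : ℂˣ) : ℂ)) 0 x *
        (((normAbs F x : ℝ≥0) : ℝ) : ℂ) ^ w ∂μ = 0 := by
  have h := (integrableOn_and_hasSum_extend_cpow μ χ hτ w hw n).2
  have h0 : ∀ i : ℕ, ∫ x in primePowBall F (n + i) \ primePowBall F (n + i + 1),
      Function.extend ((↑) : Fˣ → F) (fun u => ((χ u : ℂˣ) : ℂ)) 0 x *
        (((normAbs F x : ℝ≥0) : ℝ) : ℂ) ^ w ∂μ = 0 := by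
    intro i
    have := setIntegral_shell_mul_extend_eq_zero μ hχ (n + i)
      (fun x => (((normAbs F x : ℝ≥0) : ℝ) : ℂ) ^ w) (fun u hu x => by simp [map_mul, hu])
    simpa only [mul_comm] using this
  simp only [h0] at h
  exact h.unique hasSum_zero

/-- **`∫_{𝔭^n ∖ 0} χ̃ ‖·‖^w dμ` for unramified `χ`**: with `W = χ(ϖ) q^{-(w+1)}` (`‖W‖ < 1` in the
strip `τ + re w + 1 > 0`), it equals `μ(𝒪) (1 - q⁻¹) W^n / (1 - W)` (the geometric series over the
shells; Tate 1950, §2.5, `ζ(f, χ |·|^s)` for `f = 1_{𝔭^n}`). [folklore] -/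
theorem integral_ball_extend_cpow_of_isUnramified {χ : QuasiChar F} (hχ : χ.IsUnramified) {τ : ℝ}
    (hτ : χ.HasExponent τ) (w : ℂ) (hw : 0 < τ + w.re + 1) {ϖ : F}
    (hϖ : normAbs F ϖ = (residueFieldCard F : ℝ≥0)⁻¹) (n : ℤ) {W : ℂ}
    (hW : W = ((χ (Units.mk0 ϖ (by rintro rfl; rw [map_zero] at hϖ; exact inv_residueFieldCard_pos.ne hϖ)) :
        ℂˣ) : ℂ) * (residueFieldCard F : ℂ) ^ (-(w + 1))) :
    ‖W‖ < 1 ∧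
    ∫ x in primePowBall F n \ {0}, Function.extend ((↑) : Fˣ → F) (fun u => ((χ u : ℂˣ) : ℂ)) 0 x *
        (((normAbs F x : ℝ≥0) : ℝ) : ℂ) ^ w ∂μ =
      (μ.real (primePowBall F 0) : ℂ) * (1 - (residueFieldCard F : ℂ)⁻¹) * (W ^ n * (1 - W)⁻¹) := by
  have hϖ0 : ϖ ≠ 0 := by rintro rfl; rw [map_zero] at hϖ; exact inv_residueFieldCard_pos.ne hϖ
  set q : ℝ := (residueFieldCard F : ℝ) with hq
  have hq1 : 1 < q := by rw [hq]; exact_mod_cast one_lt_residueFieldCard F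
  have hq0 : 0 < q := zero_lt_one.trans hq1
  have hqC : (residueFieldCard F : ℂ) ≠ 0 := Nat.cast_ne_zero.2 (residueFieldCard_ne_zero F)
  -- `‖W‖ < 1`
  have hnW : ‖W‖ < 1 := by
    have h1 : ‖((χ (Units.mk0 ϖ hϖ0) : ℂˣ) : ℂ)‖ = q ^ (-τ) := by
      rw [hτ, Units.val_mk0, hϖ, NNReal.coe_inv, NNReal.coe_natCast, ← hq, Real.inv_rpow hq0.le,
        Real.rpow_neg hq0.le]
    rw [hW, norm_mul, h1, Complex.norm_natCast_cpow_of_pos (Nat.pos_of_ne_zero (residueFieldCard_ne_zero F)),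
      ← hq, ← Real.rpow_add hq0]
    simp only [Complex.neg_re, Complex.add_re, Complex.one_re]
    exact Real.rpow_lt_one_of_one_lt_of_neg hq1 (by linarith)
  refine ⟨hnW, ?_⟩
  have hW0 : W ≠ 0 := by
    rw [hW]
    exact mul_ne_zero (Units.ne_zero _) (Complex.cpow_ne_zero_iff.2 (Or.inl hqC))
  -- the shell terms
  have h := (integrableOn_and_hasSum_extend_cpow μ χ hτ w hw n).2
  have hterm : ∀ i : ℕ, ∫ x in primePowBall F (n + i) \ primePowBall F (n + i + 1),
      Function.extend ((↑) : Fˣ → F) (fun u => ((χ u : ℂˣ) : ℂ)) 0 x *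
        (((normAbs F x : ℝ≥0) : ℝ) : ℂ) ^ w ∂μ =
      (μ.real (primePowBall F 0) : ℂ) * (1 - (residueFieldCard F : ℂ)⁻¹) * W ^ n * W ^ i := by
    intro i
    rw [setIntegral_shell_mul_cpow μ _ (n + i) w, setIntegral_shell_extend_of_isUnramified μ hχ hϖ,
      LocalFieldHaar.measureReal_shell μ, natCast_cpow_neg_intCast_mul]
    have hR : (μ.real (primePowBall F 0) : ℂ) * (1 - (residueFieldCard F : ℂ)⁻¹) * W ^ n * W ^ i =
        (μ.real (primePowBall F 0) : ℂ) * (1 - (residueFieldCard F : ℂ)⁻¹) * W ^ (n + (i : ℤ)) := by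
      rw [zpow_add₀ hW0, zpow_natCast]
      ring
    have : ((residueFieldCard F : ℂ)) ^ (-(w + 1)) = (residueFieldCard F : ℂ) ^ (-w) * (residueFieldCard F : ℂ)⁻¹ := by
      rw [neg_add, Complex.cpow_add _ _ hqC, Complex.cpow_neg_one]
    rw [hR, hW, mul_zpow, this, mul_zpow]
    push_cast
    ring
  simp only [hterm] at h
  have hgeom : HasSum (fun i : ℕ => (μ.real (primePowBall F 0) : ℂ) * (1 - (residueFieldCard F : ℂ)⁻¹) * W ^ n * W ^ i)
      ((μ.real (primePowBall F 0) : ℂ) * (1 - (residueFieldCard F : ℂ)⁻¹) * W ^ n * (1 - W)⁻¹) :=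
    (hasSum_geometric_of_norm_lt_one hnW).mul_left _
  rw [h.unique hgeom]
  ring
omit [ValuativeRel F] [TopologicalSpace F] [IsNonarchimedeanLocalField F] [MeasurableSpace F] [BorelSpace F] in
/-- `‖ψ x‖ ≤ 1` (in fact `= 1`). [folklore] -/
theorem norm_addChar_coe_le_one (ψ : AddChar F Circle) (x : F) : ‖(ψ x : ℂ)‖ ≤ 1 :=
  (Circle.norm_coe _).le

/-- **The ramified `𝔅`-integral**: for `ψ` of conductor exponent `m`, `χ` ramified of conductor
exponent `c ≥ 1` and exponent `τ`, `τ + re w + 1 > 0`, and `k ∈ ℤ`,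
`∫_{𝔭^{m-k} ∖ 0} ψ χ̃ ‖·‖^w dμ = [c ≤ k] · q^{-(m-c)w} · ∫_{S_{m-c}} ψ χ̃ dμ`
(only the critical shell survives; Tate 1950, §2.5, ramified case). [folklore] -/
theorem integral_ball_addChar_mul_extend_cpow_of_ramified {ψ : AddChar F Circle} (hψ : Continuous ψ)
    {m : ℤ} (hm : ψ.HasConductorExp m) {χ : QuasiChar F} {c : ℕ} (hc : χ.HasConductorExp c)
    (hc1 : 1 ≤ c) {τ : ℝ} (hτ : χ.HasExponent τ) (w : ℂ) (hw : 0 < τ + w.re + 1) (k : ℤ) :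
    ∫ x in primePowBall F (m - k) \ {0}, (ψ x : ℂ) * Function.extend ((↑) : Fˣ → F) (fun u => ((χ u : ℂˣ) : ℂ)) 0 x *
        (((normAbs F x : ℝ≥0) : ℝ) : ℂ) ^ w ∂μ =
      if (c : ℤ) ≤ k then
        (residueFieldCard F : ℂ) ^ (-((m - c : ℤ) : ℂ) * w) *
          ∫ x in primePowBall F (m - c) \ primePowBall F (m - c + 1),
            (ψ x : ℂ) * Function.extend ((↑) : Fˣ → F) (fun u => ((χ u : ℂˣ) : ℂ)) 0 x ∂μ
      else 0 := by
  have h := (integrableOn_and_hasSum_mul_extend_cpow μ (fun x => (ψ x : ℂ)) (continuous_addChar_coe hψ).measurable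
    (norm_addChar_coe_le_one ψ) χ hτ w hw (m - k)).2
  -- the shell terms
  have hterm : ∀ i : ℕ, ∫ x in primePowBall F (m - k + i) \ primePowBall F (m - k + i + 1),
      (ψ x : ℂ) * Function.extend ((↑) : Fˣ → F) (fun u => ((χ u : ℂˣ) : ℂ)) 0 x *
        (((normAbs F x : ℝ≥0) : ℝ) : ℂ) ^ w ∂μ =
      (residueFieldCard F : ℂ) ^ (-((m - k + i : ℤ) : ℂ) * w) *
        ∫ x in primePowBall F (m - k + i) \ primePowBall F (m - k + i + 1),
          (ψ x : ℂ) * Function.extend ((↑) : Fˣ → F) (fun u => ((χ u : ℂˣ) : ℂ)) 0 x ∂μ := fun i =>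
    setIntegral_shell_mul_cpow μ _ _ w
  have hzero : ∀ i : ℕ, (i : ℤ) + c ≠ k → ∫ x in primePowBall F (m - k + i) \ primePowBall F (m - k + i + 1),
      (ψ x : ℂ) * Function.extend ((↑) : Fˣ → F) (fun u => ((χ u : ℂˣ) : ℂ)) 0 x *
        (((normAbs F x : ℝ≥0) : ℝ) : ℂ) ^ w ∂μ = 0 := by
    intro i hi
    rw [hterm i]
    rcases lt_or_gt_of_ne hi with hlt | hgt
    · rw [setIntegral_shell_addChar_mul_extend_eq_zero_of_lt μ hm hc hc1 (by omega), mul_zero]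
    · rw [setIntegral_shell_addChar_mul_extend_eq_zero_of_gt μ hm hc hc1 (by omega), mul_zero]
  split_ifs with hck
  · set i₀ : ℕ := (k - c).toNat with hi₀
    have hi₀' : (i₀ : ℤ) = k - c := Int.toNat_of_nonneg (by omega)
    have hs : HasSum (fun i : ℕ => ∫ x in primePowBall F (m - k + i) \ primePowBall F (m - k + i + 1),
        (ψ x : ℂ) * Function.extend ((↑) : Fˣ → F) (fun u => ((χ u : ℂˣ) : ℂ)) 0 x *
          (((normAbs F x : ℝ≥0) : ℝ) : ℂ) ^ w ∂μ) _ :=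
      hasSum_single i₀ fun i hi => hzero i (by
        intro h'
        apply hi
        have : (i : ℤ) = i₀ := by omega
        exact_mod_cast this)
    rw [h.unique hs, hterm i₀]
    have hidx : m - k + (i₀ : ℤ) = m - c := by omega
    rw [hidx]
  · have hs : HasSum (fun i : ℕ => ∫ x in primePowBall F (m - k + i) \ primePowBall F (m - k + i + 1),
        (ψ x : ℂ) * Function.extend ((↑) : Fˣ → F) (fun u => ((χ u : ℂˣ) : ℂ)) 0 x *
          (((normAbs F x : ℝ≥0) : ℝ) : ℂ) ^ w ∂μ) 0 := by
      have : (fun i : ℕ => ∫ x in primePowBall F (m - k + i) \ primePowBall F (m - k + i + 1),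
          (ψ x : ℂ) * Function.extend ((↑) : Fˣ → F) (fun u => ((χ u : ℂˣ) : ℂ)) 0 x *
            (((normAbs F x : ℝ≥0) : ℝ) : ℂ) ^ w ∂μ) = fun _ => 0 :=
        funext fun i => hzero i (by omega)
      rw [this]
      exact hasSum_zero
    exact h.unique hs

/-- **The unramified `𝔅`-integral**: for `ψ` of conductor exponent `m`, `χ` unramified of exponent
`τ`, `τ + re w + 1 > 0`, `k ≥ 1` and `W = χ(ϖ) q^{-(w+1)}`,
`∫_{𝔭^{m-k} ∖ 0} ψ χ̃ ‖·‖^w dμ = μ(𝒪) W^{m-1} (W - q⁻¹) / (1 - W)`: the shells below `m - 1` do not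
contribute, the shell `m - 1` gives `-q⁻¹ W^{m-1} μ(𝒪)`, and on `𝔭^m` (where `ψ = 1`) the geometric
series gives `μ(𝒪)(1 - q⁻¹) W^m/(1 - W)` (Tate 1950, §2.5, unramified case with general `ψ`). [folklore] -/
theorem integral_ball_addChar_mul_extend_cpow_of_isUnramified {ψ : AddChar F Circle} (hψ : Continuous ψ)
    {m : ℤ} (hm : ψ.HasConductorExp m) {χ : QuasiChar F} (hχ : χ.IsUnramified) {τ : ℝ}
    (hτ : χ.HasExponent τ) (w : ℂ) (hw : 0 < τ + w.re + 1) {ϖ : F}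
    (hϖ : normAbs F ϖ = (residueFieldCard F : ℝ≥0)⁻¹) {k : ℤ} (hk : 1 ≤ k) {W : ℂ}
    (hW : W = ((χ (Units.mk0 ϖ (by rintro rfl; rw [map_zero] at hϖ; exact inv_residueFieldCard_pos.ne hϖ)) :
        ℂˣ) : ℂ) * (residueFieldCard F : ℂ) ^ (-(w + 1))) :
    ∫ x in primePowBall F (m - k) \ {0}, (ψ x : ℂ) * Function.extend ((↑) : Fˣ → F) (fun u => ((χ u : ℂˣ) : ℂ)) 0 x *
        (((normAbs F x : ℝ≥0) : ℝ) : ℂ) ^ w ∂μ =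
      (μ.real (primePowBall F 0) : ℂ) * (W ^ (m - 1) * (W - (residueFieldCard F : ℂ)⁻¹) * (1 - W)⁻¹) := by
  haveI : T2Space F := (GaloisRepresentations.IsNonarchimedeanLocalField.isLocalField F).toT2Space
  have hϖ0 : ϖ ≠ 0 := by rintro rfl; rw [map_zero] at hϖ; exact inv_residueFieldCard_pos.ne hϖ
  have hqC : (residueFieldCard F : ℂ) ≠ 0 := Nat.cast_ne_zero.2 (residueFieldCard_ne_zero F)
  obtain ⟨hnW, hball⟩ := integral_ball_extend_cpow_of_isUnramified μ hχ hτ w hw hϖ m hW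
  have hW0 : W ≠ 0 := by
    rw [hW]
    exact mul_ne_zero (Units.ne_zero _) (Complex.cpow_ne_zero_iff.2 (Or.inl hqC))
  have hW1 : 1 - W ≠ 0 := by
    intro h
    rw [sub_eq_zero] at h
    rw [← h, norm_one] at hnW
    exact lt_irrefl _ hnW
  set K : ℕ := k.toNat with hK
  have hKk : (K : ℤ) = k := Int.toNat_of_nonneg (by omega)
  have hK1 : 1 ≤ K := by omega
  -- the two shell expansions
  have h1 := (integrableOn_and_hasSum_mul_extend_cpow μ (fun x => (ψ x : ℂ)) (continuous_addChar_coe hψ).measurable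
    (norm_addChar_coe_le_one ψ) χ hτ w hw (m - k)).2
  have h2 := (integrableOn_and_hasSum_mul_extend_cpow μ (fun x => (ψ x : ℂ)) (continuous_addChar_coe hψ).measurable
    (norm_addChar_coe_le_one ψ) χ hτ w hw m).2
  set t : ℕ → ℂ := fun i => ∫ x in primePowBall F (m - k + i) \ primePowBall F (m - k + i + 1),
      (ψ x : ℂ) * Function.extend ((↑) : Fˣ → F) (fun u => ((χ u : ℂˣ) : ℂ)) 0 x *
        (((normAbs F x : ℝ≥0) : ℝ) : ℂ) ^ w ∂μ with ht
  -- shell values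
  have hterm : ∀ i : ℕ, t i = (residueFieldCard F : ℂ) ^ (-((m - k + i : ℤ) : ℂ) * w) *
      (((χ (Units.mk0 ϖ hϖ0) : ℂˣ) : ℂ) ^ (m - k + i) *
        ((if m ≤ m - k + i then (μ.real (primePowBall F (m - k + i)) : ℂ) else 0) -
          (if m ≤ m - k + i + 1 then (μ.real (primePowBall F (m - k + i + 1)) : ℂ) else 0))) := by
    intro i
    rw [ht]
    simp only
    rw [setIntegral_shell_mul_cpow μ _ _ w, setIntegral_shell_addChar_mul_extend_of_isUnramified μ hψ hm hχ hϖ]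
  -- shifting the first expansion by `K` gives the second
  have hshift : (fun i : ℕ => t (i + K)) = fun i : ℕ => ∫ x in primePowBall F (m + i) \ primePowBall F (m + i + 1),
      (ψ x : ℂ) * Function.extend ((↑) : Fˣ → F) (fun u => ((χ u : ℂˣ) : ℂ)) 0 x *
        (((normAbs F x : ℝ≥0) : ℝ) : ℂ) ^ w ∂μ := by
    funext i
    have hidx : m - k + ((i + K : ℕ) : ℤ) = m + i := by push_cast; omega
    rw [ht]
    simp only
    rw [hidx]
  have h3 := (hasSum_nat_add_iff' (f := t) K).2 h1
  rw [hshift] at h3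
  have hT : (∫ x in primePowBall F (m - k) \ {0}, (ψ x : ℂ) * Function.extend ((↑) : Fˣ → F) (fun u => ((χ u : ℂˣ) : ℂ)) 0 x *
        (((normAbs F x : ℝ≥0) : ℝ) : ℂ) ^ w ∂μ) - ∑ i ∈ Finset.range K, t i =
      ∫ x in primePowBall F m \ {0}, (ψ x : ℂ) * Function.extend ((↑) : Fˣ → F) (fun u => ((χ u : ℂˣ) : ℂ)) 0 x *
        (((normAbs F x : ℝ≥0) : ℝ) : ℂ) ^ w ∂μ := h3.unique h2
  -- the finite sum is its last term
  have hfin : ∑ i ∈ Finset.range K, t i = t (K - 1) := by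
    refine Finset.sum_eq_single_of_mem (K - 1) (Finset.mem_range.2 (by omega)) fun i hi hne => ?_
    rw [Finset.mem_range] at hi
    rw [hterm i, if_neg (by omega), if_neg (by omega), sub_zero, mul_zero, mul_zero]
  have hlast : t (K - 1) = -((residueFieldCard F : ℂ)⁻¹ * W ^ (m - 1) * (μ.real (primePowBall F 0) : ℂ)) := by
    rw [hterm (K - 1), if_neg (by omega), if_pos (by omega), zero_sub]
    have hidx : m - k + ((K - 1 : ℕ) : ℤ) = m - 1 := by push_cast [Nat.cast_sub hK1]; omega
    rw [hidx, sub_add_cancel, LocalFieldHaar.measureReal_primePowBall μ m, natCast_cpow_neg_intCast_mul, hW, mul_zpow]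
    have : ((residueFieldCard F : ℂ)) ^ (-(w + 1)) = (residueFieldCard F : ℂ) ^ (-w) * (residueFieldCard F : ℂ)⁻¹ := by
      rw [neg_add, Complex.cpow_add _ _ hqC, Complex.cpow_neg_one]
    rw [this, mul_zpow]
    have hqm : ((residueFieldCard F : ℂ))⁻¹ ^ m = (residueFieldCard F : ℂ)⁻¹ ^ (m - 1) * (residueFieldCard F : ℂ)⁻¹ := by
      rw [zpow_sub_one₀ (inv_ne_zero hqC), inv_inv, mul_assoc, mul_inv_cancel₀ hqC, mul_one]
    push_cast
    rw [hqm]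
    ring
  -- on `𝔭^m`, `ψ = 1`
  have hinner : ∫ x in primePowBall F m \ {0}, (ψ x : ℂ) * Function.extend ((↑) : Fˣ → F) (fun u => ((χ u : ℂˣ) : ℂ)) 0 x *
        (((normAbs F x : ℝ≥0) : ℝ) : ℂ) ^ w ∂μ =
      (μ.real (primePowBall F 0) : ℂ) * (1 - (residueFieldCard F : ℂ)⁻¹) * (W ^ m * (1 - W)⁻¹) := by
    rw [← hball]
    refine setIntegral_congr_fun ((measurableSet_primePowBall m).diff (measurableSet_singleton 0))
      fun x hx => ?_
    rw [hm.1 x hx.1, Circle.coe_one, one_mul]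
  rw [hfin, hlast, hinner] at hT
  have hWm : W ^ m = W ^ (m - 1) * W := by rw [zpow_sub_one₀ hW0, inv_mul_cancel_right₀ hW0]
  rw [sub_eq_iff_eq_add] at hT
  rw [hT, hWm]
  field_simp
  ring
end Shells

end TateDirect

end Literature.NumberTheory.Automorphic
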